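import Summits.QuantumFields.BalabanUV.Beta.GAN24.DerivativeRateTransferLoewner

/-!
# `BalabanUV.Beta.GAN24.DerivativeRateTransferLoewnerCov` — binder row G-an2-4 ∕ (CONV-C), route R6 «VALUES, NOT DERIVATIVES», PART 16:
# THE COVARIANCE ROWS FOLLOW — over an INCREASING tower of effective forms with entry one-step rate `c·θ^k` (PART 15), the next-constraint
# fluctuation covariances `Γ_k = Γ(Δ_eff^{(k)}, Q)` DECREASE (road P4), and their diagonal decrements are bounded by ONE trial field
# (the previous column): `Γ_k(y,y) − Γ_{k+1}(y,y) ≤ re ⟨Γ_k e_y, (Δ_eff^{(k+1)} − Δ_eff^{(k)}) Γ_k e_y⟩ ≤ c·θ^k·‖Γ_k e_y‖₁²` — so the `Γ`-rows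
# inherit the rate with NO new estimate beyond a k-uniform column bound (unit b2b-balaban-gan24-p3, gen 36; v1)

NOT IN PRINT; OUR PROOF (for the ROUTE; [folklore] finite-dimensional linear algebra — road P4's `MonotoneBlocks.pairing_sub_form_le` (completing the
square) ∕ `flucCov_antitone`, p3's `PropagatorWoodburyFibre` KKT identities, PART 15 and PART 7 BY NAME).  HONEST FRAMING (cell contract, verbatim):
«discharging `BetaPertH` makes Bałaban's UV stability UNCONDITIONAL — a real constructive-QFT result; it is NOT the continuum limit and NOT the Clay
problem.»  HONEST DEPENDENCY (verbatim): «continuum YM on T⁴ ⇐ BetaPertH ∧ nine spine estimates (0/9 proved); BetaPertH ⇐ (D1) ∧ (D4) ∧ CAP+tail;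
G-an2-4 gates asym, D1 and NE2/3/4.»

WHY THIS FILE.  PART 15 (`DerivativeRateTransferLoewner`) reduced the with-background value rate S1 of the EFFECTIVE-FORM rows to (STAB) + (CONS).  The
(MF′) one-step map also carries the unit-level COVARIANCE letter — the fluctuation covariance of the composite effective form under the NEXT constraint,
`Γ_k := Γ(E_k, Q) = E_k⁻¹ − E_k⁻¹Qᴴ(QE_k⁻¹Qᴴ)⁻¹QE_k⁻¹` (road P4's «wall's resolvent slot», `MonotoneComposite.flucCov_chain_step`; an1's `Γ` block of the
bordered inverse).  Road P4 proved it DECREASES along an increasing tower (`flucCov_antitone`, Anderson–Trapp) and drew the rate-free (MONO-K)₂ from ONE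
trace datum.  THIS FILE gives the RATE: the Gaussian variational principle for the covariance (`⟨x, Γ′x⟩ = max over Q-admissible g of 2re⟨x,g⟩ − ⟨g,E′g⟩`,
road P4's completing-the-square `pairing_sub_form_le`) tested at the PREVIOUS covariance column `g = Γ_k e_y` bounds the diagonal decrement by the
quadratic form of the STEP `E_{k+1} − E_k` at that column; PART 15's entry bound on the step and a k-uniform `ℓ¹` column bound finish — and PART 15 §1∕§2
turn the diagonal rate into an entry rate and (with S2) into derivative rows.  Net: for BOTH symmetric unit-level blocks of the (MF′) algebra (effective
form AND covariance) S1-with-background ⇐ (STAB) + (CONS) + a k-uniform column bound (a decay ∕ (H2)-type bound, K-slot currency) — still no fibre and no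
translation invariance.  The minimiser LEGS stay R7 (ρ3)'s; fine × fine covariances stay under V40.

WHAT THIS FILE PROVES (0 sorry, 0 `def`, nothing cited):
* §1 `norm_star_dotProduct_mulVec_le` — `‖⟨g, Dg⟩‖ ≤ δ·(Σ_a ‖g_a‖)²` when all `‖D_{ab}‖ ≤ δ`; `sum_norm_mulVec_single` (the trial field's `ℓ¹` norm is
  the column sum).
* §2 **`re_flucCov_diag_sub_le`** — `0 < E`, `0 < E′`, `Q` with independent rows: `re Γ(E,Q)_{yy} − re Γ(E′,Q)_{yy} ≤ re ⟨Γ(E,Q)e_y, (E′ − E)·Γ(E,Q)e_y⟩`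
  (no order between `E` and `E′` needed); `re_flucCov_diag_sub_le_of_entry` (`≤ δ·(Σ_a ‖Γ(E,Q)_{ay}‖)²` when the step has entries `≤ δ`).
* §3 THE TOWER END **`flucCov_entry_step_rate_of_effForm_rate`** — `E_k` positive definite and increasing with `‖(E_{k+1} − E_k)_{ab}‖ ≤ c·θ^k`, columns
  `Σ_a ‖(Γ_k)_{ay}‖ ≤ M` ⟹ `‖(Γ_{k+1})_{ab} − (Γ_k)_{ab}‖ ≤ c·M²·θ^k` for all `k, a, b`; and **`flucCov_entry_step_rate_of_stab_of_cons`** — the same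
  from PART 15's (STAB) + (CONS) for `E_k = Δ_eff(H_k, Qc_k)`.
* §4 `entry_rate_of_loewner'` ∕ **`deriv_entry_step_rateω'`** — PART 15 §2 for DECREASING families (covariances): PSD steps `F k s − F (k+1) s` with
  diagonal rate on the real segment + S2 ⟹ the derivative rows inherit the rate.
WHAT IT DOES NOT DO: discharge (STAB), (CONS) or the column bound for any of Bałaban's operators; identify `Γ(E_k, Q)` with a printed object (S2(ii));
serve legs or fine × fine rows.  SUPPLIER work on route R6 (rank 2, REDUCTION, no seat); no consumer of record; NEVER «G-an2-4 closed»; NOT (CONV-C),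
NOT D1, NOT `BetaPertH`, NOT continuum, NOT Clay.  Records: `HOME/b2b-balaban-gan24-p3/WOODBURY-FIBRE.md` v13.6.
-/

noncomputable section

open Set Metric Matrix

namespace Summit.QuantumFields.BalabanUV.Beta.GAN24.DerivativeRateTransferLoewnerCov

open scoped ComplexOrder
open Summit.QuantumFields.BalabanUV.Beta.PropagatorWoodburyFibre
open Summit.QuantumFields.BalabanUV.Beta.GAN24.MonotoneBlocks (pairing_sub_form_le flucCov_antitone)
open Summit.QuantumFields.BalabanUV.Beta.GAN24.DerivativeRateTransferAnalytic (deriv_step_rateω)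
open Summit.QuantumFields.BalabanUV.Beta.GAN24.DerivativeRateTransferLoewner (norm_apply_le_of_diag_le norm_step_apply_le_of_diag'
  star_single_dotProduct_mulVec_single star_mulVec_dotProduct' energy_conj effForm_entry_step_rate_of_stab_of_cons)

/-! ## §1 Quadratic forms against entry bounds -/

section Entry

variable {n : Type*} [Fintype n]

/-- [folklore] `‖⟨g, Dg⟩‖ ≤ δ·(Σ_a ‖g_a‖)²` if every entry of `D` has norm `≤ δ`. -/
theorem norm_star_dotProduct_mulVec_le (D : Matrix n n ℂ) {δ : ℝ} (hD : ∀ a b, ‖D a b‖ ≤ δ) (g : n → ℂ) :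
    ‖star g ⬝ᵥ (D *ᵥ g)‖ ≤ δ * (∑ a, ‖g a‖) ^ 2 := by
  simp only [dotProduct, mulVec, Pi.star_apply]
  calc ‖∑ a, star (g a) * ∑ b, D a b * g b‖
      ≤ ∑ a, ‖star (g a) * ∑ b, D a b * g b‖ := norm_sum_le _ _
    _ ≤ ∑ a, ‖g a‖ * (δ * ∑ b, ‖g b‖) := by
        refine Finset.sum_le_sum fun a _ => ?_
        rw [norm_mul, norm_star]
        refine mul_le_mul_of_nonneg_left ((norm_sum_le _ _).trans ?_) (norm_nonneg _)
        rw [Finset.mul_sum]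
        exact Finset.sum_le_sum fun b _ => by
          rw [norm_mul]; exact mul_le_mul_of_nonneg_right (hD a b) (norm_nonneg _)
    _ = δ * (∑ a, ‖g a‖) ^ 2 := by rw [← Finset.sum_mul, sq]; ring

variable [DecidableEq n]

/-- [folklore] the `ℓ¹` norm of the column `Γ e_y` is the column sum `Σ_a ‖Γ_{ay}‖`. -/
theorem sum_norm_mulVec_single (Γ : Matrix n n ℂ) (y : n) : ∑ a, ‖(Γ *ᵥ Pi.single y 1) a‖ = ∑ a, ‖Γ a y‖ := by
  simp [Matrix.col_apply]

end Entry

/-! ## §2 The diagonal decrement of the fluctuation covariance is bounded by the step tested at the previous column -/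

section Covariance

variable {c m : Type*} [Fintype c] [Fintype m] [DecidableEq c] [DecidableEq m]
variable {E E' : Matrix c c ℂ} {Q : Matrix m c ℂ}

/-- **THE COVARIANCE's DIAGONAL DECREMENT ≤ THE STEP AT THE OLD COLUMN** [our proof over road P4's completing-the-square]: `0 < E`, `0 < E′`, `Q` with
independent rows, `Γ := Γ(E,Q)`, `Γ′ := Γ(E′,Q)`: `re Γ_{yy} − re Γ′_{yy} ≤ re ⟨Γe_y, (E′ − E) Γe_y⟩`.  (The variational principle
`⟨e_y, Γ′e_y⟩ ≥ 2re⟨e_y, g⟩ − ⟨g, E′g⟩` for every `g` with `Qg = 0`, at `g = Γe_y`, using `⟨e_y, Γe_y⟩ = ⟨Γe_y, EΓe_y⟩ = Γ_{yy}`.) [folklore] -/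
theorem re_flucCov_diag_sub_le (hE : E.PosDef) (hE' : E'.PosDef) (hQ : Function.Injective Q.vecMul) (y : c) :
    (flucCov E Q y y).re - (flucCov E' Q y y).re ≤
      (star (flucCov E Q *ᵥ Pi.single y 1) ⬝ᵥ ((E' - E) *ᵥ (flucCov E Q *ᵥ Pi.single y 1))).re := by
  have hP := isUnit_pivot_of_posDef hE hQ
  have hP' := isUnit_pivot_of_posDef hE' hQ
  have hΓh : (flucCov E Q)ᴴ = flucCov E Q := flucCov_conjTranspose hE.isHermitian
  have hΓ'h : (flucCov E' Q)ᴴ = flucCov E' Q := flucCov_conjTranspose hE'.isHermitian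
  set x : c → ℂ := Pi.single y 1 with hx
  set g : c → ℂ := flucCov E Q *ᵥ x with hg
  have hQg : Q *ᵥ g = 0 := by rw [hg, mulVec_mulVec, constraint_mul_flucCov hP, zero_mulVec]
  -- the next covariance is its own compression: Γ′ᴴ E′ Γ′ = Γ′
  have h1 : (flucCov E' Q)ᴴ * E' * flucCov E' Q = flucCov E' Q := by
    rw [hΓ'h]; exact flucCov_mul_form_mul_flucCov hE'.isUnit hP'
  -- admissibility of `g` for the `E′`-problem: both from `Q g = 0`
  have hadm₁ : star x ⬝ᵥ (((flucCov E' Q)ᴴ * E') *ᵥ g) = star x ⬝ᵥ g := by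
    rw [hΓ'h, flucCov_mul_form hE'.isUnit, sub_mulVec, one_mulVec, ← mulVec_mulVec, hQg, mulVec_zero, sub_zero]
  have hadm₂ : star g ⬝ᵥ ((E' * flucCov E' Q) *ᵥ x) = star g ⬝ᵥ x := by
    rw [form_mul_flucCov hE'.isUnit, sub_mulVec, one_mulVec, dotProduct_sub, ← mulVec_mulVec,
      ← star_mulVec_dotProduct' Q g, hQg, star_zero, zero_dotProduct, sub_zero]
  have key := pairing_sub_form_le E' (flucCov E' Q) hE'.posSemidef h1 x g hadm₁ hadm₂
  -- read the four pairings
  have e1 : star x ⬝ᵥ g = flucCov E Q y y := by rw [hg, hx, star_single_dotProduct_mulVec_single]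
  have e2 : star g ⬝ᵥ x = flucCov E Q y y := by
    rw [hg, star_mulVec_dotProduct', hΓh, hx, star_single_dotProduct_mulVec_single]
  have e3 : star x ⬝ᵥ (flucCov E' Q *ᵥ x) = flucCov E' Q y y := by rw [hx, star_single_dotProduct_mulVec_single]
  have e4 : star g ⬝ᵥ (E *ᵥ g) = flucCov E Q y y := by
    rw [hg, energy_conj, hΓh, flucCov_mul_form_mul_flucCov hE.isUnit hP, hx, star_single_dotProduct_mulVec_single]
  rw [e1, e2, e3] at key
  have hre := (Complex.le_def.mp key).1
  simp only [Complex.add_re, Complex.sub_re] at hre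
  rw [Matrix.sub_mulVec, dotProduct_sub, Complex.sub_re, e4]
  linarith

/-- **… ≤ δ·(column `ℓ¹` norm)²** when the step `E′ − E` has entries of norm `≤ δ`. [folklore] -/
theorem re_flucCov_diag_sub_le_of_entry (hE : E.PosDef) (hE' : E'.PosDef) (hQ : Function.Injective Q.vecMul) {δ : ℝ}
    (hD : ∀ a b, ‖(E' - E) a b‖ ≤ δ) (y : c) :
    (flucCov E Q y y).re - (flucCov E' Q y y).re ≤ δ * (∑ a, ‖flucCov E Q a y‖) ^ 2 := by
  refine (re_flucCov_diag_sub_le hE hE' hQ y).trans ((Complex.re_le_norm _).trans ?_)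
  rw [← sum_norm_mulVec_single]
  exact norm_star_dotProduct_mulVec_le _ hD _

end Covariance

/-! ## §3 The tower END: the covariance rows inherit the rate of the effective-form steps -/

section Tower

variable {c m : Type*} [Fintype c] [Fintype m] [DecidableEq c] [DecidableEq m]
variable {E : ℕ → Matrix c c ℂ} {Q : Matrix m c ℂ} {cst θ M : ℝ}

/-- **`flucCov_entry_step_rate_of_effForm_rate` — THE Γ-ROWS FROM THE EFFECTIVE-FORM ROWS** [our proof]: `E_k` positive definite and INCREASING
(`0 ≤ E_{k+1} − E_k`) with entry one-step rate `‖(E_{k+1} − E_k)_{ab}‖ ≤ cst·θ^k`, `Q` with independent rows, and a k-uniform column bound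
`Σ_a ‖Γ(E_k,Q)_{ay}‖ ≤ M` ⟹ `‖Γ(E_{k+1},Q)_{ab} − Γ(E_k,Q)_{ab}‖ ≤ cst·M²·θ^k` for all `k, a, b` (road P4's `flucCov_antitone` gives the PSD
decrements; §2 the diagonal; PART 15 §1 the entries). -/
theorem flucCov_entry_step_rate_of_effForm_rate (hE : ∀ k, (E k).PosDef) (hmono : ∀ k, (E (k + 1) - E k).PosSemidef)
    (hrate : ∀ k a b, ‖E (k + 1) a b - E k a b‖ ≤ cst * θ ^ k) (hQ : Function.Injective Q.vecMul)
    (hcol : ∀ k y, ∑ a, ‖flucCov (E k) Q a y‖ ≤ M) :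
    ∀ k a b, ‖flucCov (E (k + 1)) Q a b - flucCov (E k) Q a b‖ ≤ cst * M ^ 2 * θ ^ k := by
  have hstep : ∀ k, 0 ≤ k → (flucCov (E k) Q - flucCov (E (k + 1)) Q).PosSemidef := fun k _ =>
    flucCov_antitone (hE k) (hE (k + 1)) (hmono k) hQ
  have hdiag : ∀ k, 0 ≤ k → ∀ y, ((flucCov (E k) Q - flucCov (E (k + 1)) Q) y y).re ≤ cst * M ^ 2 * θ ^ k := by
    intro k _ y
    have hθk : 0 ≤ cst * θ ^ k := (norm_nonneg _).trans (hrate k y y)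
    rw [Matrix.sub_apply, Complex.sub_re]
    have h := re_flucCov_diag_sub_le_of_entry (hE k) (hE (k + 1)) hQ (δ := cst * θ ^ k)
      (fun a b => by rw [Matrix.sub_apply]; exact hrate k a b) y
    refine h.trans ?_
    have hs : (∑ a, ‖flucCov (E k) Q a y‖) ^ 2 ≤ M ^ 2 :=
      pow_le_pow_left₀ (Finset.sum_nonneg fun a _ => norm_nonneg _) (hcol k y) 2
    calc cst * θ ^ k * (∑ a, ‖flucCov (E k) Q a y‖) ^ 2 ≤ cst * θ ^ k * M ^ 2 :=
          mul_le_mul_of_nonneg_left hs hθk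
      _ = cst * M ^ 2 * θ ^ k := by ring
  intro k a b
  exact norm_step_apply_le_of_diag' (P := fun k => flucCov (E k) Q) hstep hdiag k (Nat.zero_le k) a b

variable {ι : ℕ → Type*} [∀ j, Fintype (ι j)] [∀ j, DecidableEq (ι j)]
variable {H : ∀ j, Matrix (ι j) (ι j) ℂ} {Qf : ∀ j, Matrix (ι j) (ι (j + 1)) ℂ} {Qc : ∀ j, Matrix c (ι j) ℂ}
variable {P : ∀ j, Matrix (ι (j + 1)) (ι j) ℂ}

/-- **`flucCov_entry_step_rate_of_stab_of_cons` — (STAB) + (CONS) + A COLUMN BOUND ⟹ THE Γ-ROWS' ENTRY RATE** [our proof]: PART 15's tower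
hypotheses ((STAB_j), (CONS_{j,y}), `Qc (j+1) = Qc j · Qf j`, `Qc (j+1) · P j = Qc j`) for the composite effective forms `E_j = Δ_eff(H_j, Qc_j)`, a next
constraint `Q` with independent rows and `Σ_a ‖Γ(E_j,Q)_{ay}‖ ≤ M` ⟹ `‖Γ(E_{j+1},Q)_{ab} − Γ(E_j,Q)_{ab}‖ ≤ cst·M²·θ^j`. -/
theorem flucCov_entry_step_rate_of_stab_of_cons (hH : ∀ j, (H j).PosDef) (hQf : ∀ j, Function.Injective (Qf j).vecMul)
    (hQc : ∀ j, Function.Injective (Qc j).vecMul) (hcomp : ∀ j, Qc (j + 1) = Qc j * Qf j) (hPQ : ∀ j, Qc (j + 1) * P j = Qc j)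
    (hstab : ∀ j, (H (j + 1) - (Qf j)ᴴ * H j * Qf j).PosSemidef)
    (hcons : ∀ j (y : c),
      (star (minimiser (H j) (Qc j) *ᵥ Pi.single y 1) ⬝ᵥ
        (((P j)ᴴ * H (j + 1) * P j - H j) *ᵥ (minimiser (H j) (Qc j) *ᵥ Pi.single y 1))).re ≤ cst * θ ^ j)
    (hQ : Function.Injective Q.vecMul)
    (hcol : ∀ j y, ∑ a, ‖flucCov (effForm (H j) (Qc j)) Q a y‖ ≤ M) :
    ∀ j a b, ‖flucCov (effForm (H (j + 1)) (Qc (j + 1))) Q a b - flucCov (effForm (H j) (Qc j)) Q a b‖ ≤ cst * M ^ 2 * θ ^ j := by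
  refine flucCov_entry_step_rate_of_effForm_rate (E := fun j => effForm (H j) (Qc j)) (fun j => effForm_posDef (hH j) (hQc j))
    (fun j => ?_) (effForm_entry_step_rate_of_stab_of_cons hH hQf hQc hcomp hPQ hstab hcons) hQ hcol
  exact MonotoneCoarsen.effForm_chain_step_of_stab (k₀ := 0) hH hQf hQc hcomp (fun j _ => hstab j) j (Nat.zero_le j)

end Tower

/-! ## §4 The derivative rows of DECREASING families (PART 15 §2 with the order reversed) -/

section Join

variable {n : Type*} {F : ℕ → ℂ → Matrix n n ℂ} {ρ s₁ B c θ : ℝ}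

/-- the entry families of a decreasing matrix family along the real segment. [folklore] -/
theorem entry_rate_of_loewner'
    (hmono : ∀ k (s : ℝ), 0 ≤ s → s ≤ s₁ → (F k (s : ℂ) - F (k + 1) (s : ℂ)).PosSemidef)
    (hdiag : ∀ k (s : ℝ), 0 ≤ s → s ≤ s₁ → ∀ a, ((F k (s : ℂ) - F (k + 1) (s : ℂ)) a a).re ≤ c * θ ^ k) (a b : n) :
    ∀ k (s : ℝ), 0 ≤ s → s ≤ s₁ → ‖F (k + 1) (s : ℂ) a b - F k (s : ℂ) a b‖ ≤ c * θ ^ k := fun k s hs0 hs1 => by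
  rw [← norm_neg, neg_sub]
  simpa only [Matrix.sub_apply] using norm_apply_le_of_diag_le (hmono k s hs0 hs1) (hdiag k s hs0 hs1) a b

/-- **`deriv_entry_step_rateω'` — DECREASING LOEWNER DATA ON THE REAL SEGMENT + S2 ⟹ THE DERIVATIVE ROWS INHERIT THE RATE** [our proof, PART 7 BY
NAME]: as PART 15's `deriv_entry_step_rateω` with the steps `F k s − F (k+1) s` PSD (covariances decrease). -/
theorem deriv_entry_step_rateω' (hs₁ : 0 < s₁) (hs₁ρ : s₁ * Real.cosh 1 < ρ)
    (hF : ∀ k a b, DifferentiableOn ℂ (fun z => F k z a b) (ball (0 : ℂ) ρ))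
    (hB : ∀ k a b, ∀ z ∈ ball (0 : ℂ) ρ, ‖F k z a b‖ ≤ B)
    (hmono : ∀ k (s : ℝ), 0 ≤ s → s ≤ s₁ → (F k (s : ℂ) - F (k + 1) (s : ℂ)).PosSemidef)
    (hdiag : ∀ k (s : ℝ), 0 ≤ s → s ≤ s₁ → ∀ a, ((F k (s : ℂ) - F (k + 1) (s : ℂ)) a a).re ≤ c * θ ^ k)
    (hc : 0 < c) (hθ : 0 < θ) {r : ℝ} (hr : 0 < r) (hr1 : r ≤ 1) (k : ℕ) (a b : n) :
    ‖deriv (fun z => F (k + 1) z a b) 0 - deriv (fun z => F k z a b) 0‖ ≤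
      25 * (2 * B) ^ r / (s₁ * r ^ 2) * c ^ (1 - r) * (θ ^ (1 - r)) ^ k :=
  deriv_step_rateω (F := fun k z => F k z a b) hs₁ hs₁ρ (fun k => hF k a b) (fun k => hB k a b)
    (entry_rate_of_loewner' hmono hdiag a b) hc hθ hr hr1 k

end Join

end Summit.QuantumFields.BalabanUV.Beta.GAN24.DerivativeRateTransferLoewnerCov

end
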